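import Mathlib.Analysis.ODE.Gronwall
import Mathlib.Analysis.Complex.CauchyIntegral
import Literature.Probability.RandomPlanarGeometry.WholePlaneSLE
import HarnessLib

/-!
# Whole-plane SLE_κ(ρ): proved glue of the existence proof

Topic `Probability/RandomPlanarGeometry`; theorems only, sequel of `WholePlaneSLE`. The named fact
`IsWholePlaneSLEKappaRho.exists` (Miller–Sheffield (2013), Prop. 2.5 with Prop. 2.1 and Lawler
(2005), Prop. 4.21) says that in the non-hitting regime `0 < κ ≤ 2(ρ + 2)` some probability space
carries a whole-plane SLE_κ(ρ) curve from `0` to `∞`. Its published proof has four steps: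
(1) the stationary angle law `P₀` exists (Miller–Sheffield (2013), Prop. 2.1 — the named fact
`IsStationaryAngleLaw.exists_unique`); (2) realise the driving data on `Ω = C(ℝ, ℝ) × ℝ`,
`P = P₀ ⊗ uniformAngleLaw`, `X = fst`, `q₀ = snd`; (3) almost surely the driving angle
`drivingOfAngle q₀ X` is continuous, so its whole-plane Loewner chain exists (Lawler (2005),
Prop. 4.21 — the named fact `WholePlaneLoewnerChain.exists_unique`); (4) the chain is a.s.
generated by a continuous curve (Miller–Sheffield (2013), Prop. 2.5: on `[T, ∞)` the hulls are the
conformal image of a radial SLE_κ(ρ), continuous by their Prop. 2.3 and non-boundary-hitting by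
their Lemma 2.4; then `T → -∞`). This file proves the parts of that argument that do not depend on
the deep inputs:

* `continuous_drivingOfAngle`, `hasDerivAt_drivingOfAngle_sub` (`q̇ = -cot(X/2)`, the force-point
  line of Miller–Sheffield's eq. (2.1)), `drivingOfAngle_add` (shift covariance — the identity behind
  the time-stationarity of the driving process), `measurable_drivingOfAngle` (joint measurability
  in the data `(X, q₀)`);
* `IsWholePlaneSLEKappaRho.exists_drivingData`: steps (1)–(3), conditional on the two named facts
  as hypotheses (product realisation `IsStationaryAngleLaw.indepFun_fst_snd`, Mathlib's
  `indepFun_prod`);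
* towards step (4): `WholePlaneLoewnerChain.eventually_hull_subset` (the hulls shrink into every
  neighbourhood of `0`, from `⋂ Kₜ = {0}` and compactness), `isCompact_insert_image_Iic`
  (`{0} ∪ γ(-∞, t]` is compact) and `WholePlaneLoewnerChain.isCurve_of_forall_lt`: if for all
  `T < t` the Loewner domain `ℂ ∖ Kₜ` is the unbounded component of `ℂ ∖ (γ[T, t] ∪ K_T)` (the
  Markovian form delivered by the radial description in Miller–Sheffield's proof of Prop. 2.5),
  then `ℂ ∖ Kₜ` is the unbounded component of `ℂ ∖ ({0} ∪ γ(-∞, t])`, i.e. `C.IsCurve γ`;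
  and the deterministic half of "whole-plane SLE is a bi-infinite radial SLE"
  (Miller–Sheffield (2013), §2.1.3): off the hull `gₜ(z)` lies in `{1 < |z|}`
  (`WholePlaneLoewnerChain.map_mem_exteriorDisc`) and `hₛ = 1/gₛ(z)` solves the radial Loewner
  equation in `𝔻` driven by the conjugate point `exp (-i·lam)`
  (`WholePlaneLoewnerChain.hasDerivAt_inv_map`).

* the **uniqueness half of the named fact `WholePlaneLoewnerChain.exists_unique`** (Lawler
  (2005), Prop. 4.21), proved for every driving angle: `WholePlaneLoewnerChain.unique` (same hulls,
  same maps off the hulls), via the pointwise uniqueness of trajectories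
  `WholePlaneLoewnerChain.map_eq_of_notMem_hull` (contraction of `eˢ(gₛ - g'ₛ)` near `s = -∞`,
  `norm_rescaled_deriv_le`, then Grönwall with the local Lipschitz bound
  `WholePlaneLoewner.norm_field_sub_field_le`) and the identity theorem for the inverse
  uniformizers on the exterior disc (`isPreconnected_exteriorDisc`); whence the reduction
  `WholePlaneLoewnerChain.exists_unique_of_forall_nonempty` of that named fact to pure existence.

What is NOT here (the deep inputs, all unproved named facts or not yet vendored): the stationary
angle law (MS Prop. 2.1), the EXISTENCE of the whole-plane Loewner chain (Lawler Prop. 4.21), and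
the continuity of radial / whole-plane SLE_κ(ρ) (MS Prop. 2.3 / 2.5, over Schramm–Wilson,
Girsanov, Imaginary Geometry I and Rohde–Schramm). No definition and no named fact is introduced.

## References

* J. Miller, S. Sheffield, *Imaginary geometry IV: interior rays, whole-plane reversibility, and
  space-filling trees*, Probab. Theory Related Fields 169 (2017), arXiv:1302.4738: §2.1.2 eq. (2.1),
  Prop. 2.1, §2.1.3, Prop. 2.5 and its proof (p. 18 of arXiv v3). [MillerSheffield2013]
* G. F. Lawler, *Conformally Invariant Processes in the Plane*, AMS (2005), §4.3, Lemma 4.20,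
  Prop. 4.21 (existence and uniqueness of the whole-plane chain; the rescaling `eᵗ gₜ`). [Lawler2005]
* D. Zhan, *SLE loop measures*, Probab. Theory Related Fields 179 (2021), arXiv:1702.08026, §3
  (`λ = q + X`, `dq = -cot₂(X) dt`). [Zhan2021SLELoopMeasures]
-/

noncomputable section

open Set Filter Topology MeasureTheory ProbabilityTheory Complex
open scoped NNReal Real ENNReal

namespace Literature.Probability.RandomPlanarGeometry

open scoped PathBorel

/-! ### Glue for the existence of whole-plane SLE_κ(ρ): the driving data -/

section Glue

/-- The half-angle cotangent `x ↦ cot (x / 2)` is continuous on `(0, 2π)` (there `sin (x/2) > 0`).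
(The same statement as `RadialLoewner.continuousOn_cot_half` of `RadialBesselODE`, repeated here so
that this file does not import the Itô-calculus tower of the radial Bessel files.) [folklore] -/
theorem continuousOn_cot_div_two : ContinuousOn (fun x : ℝ ↦ Real.cot (x / 2)) (Ioo 0 (2 * π)) := by
  have hsin : ∀ x ∈ Ioo (0 : ℝ) (2 * π), Real.sin (x / 2) ≠ 0 := fun x hx ↦
    (Real.sin_pos_of_pos_of_lt_pi (by linarith [hx.1]) (by linarith [hx.2])).ne'
  have : (fun x : ℝ ↦ Real.cot (x / 2)) = fun x ↦ Real.cos (x / 2) / Real.sin (x / 2) := by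
    funext x; exact Real.cot_eq_cos_div_sin (x / 2)
  rw [this]
  exact ((Real.continuous_cos.comp (continuous_id.div_const _)).continuousOn).div
    ((Real.continuous_sin.comp (continuous_id.div_const _)).continuousOn) hsin

/-- Along a two-sided path with values in `(0, 2π)` the drift integrand `u ↦ cot (x u / 2)` of the
force-point phase (`dq = -cot(X/2) dt`) is continuous. [folklore] -/
theorem continuous_cot_half_path (x : C(ℝ, ℝ)) (hx : ∀ t, x t ∈ Ioo 0 (2 * π)) :
    Continuous fun u ↦ Real.cot (x u / 2) :=
  continuousOn_cot_div_two.comp_continuous x.continuous hx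

/-- **The driving angle of a non-hitting angle path is continuous**: if `X` stays in `(0, 2π)`
then `t ↦ drivingOfAngle q₀ X t = q₀ - ∫₀ᵗ cot(X_u/2) du + X_t` is continuous — the hypothesis
under which the whole-plane Loewner chain driven by `exp (i · drivingOfAngle q₀ X)` exists
(`WholePlaneLoewnerChain.exists_unique`). Zhan (2021), §3 (`λ = q + X` with `q̇ = -cot₂(X)`,
`X ∈ (0, 2π)`). [folklore] -/
theorem continuous_drivingOfAngle (q₀ : ℝ) (x : C(ℝ, ℝ)) (hx : ∀ t, x t ∈ Ioo 0 (2 * π)) :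
    Continuous (drivingOfAngle q₀ x) := by
  have hc := continuous_cot_half_path x hx
  have hprim : Continuous fun t ↦ ∫ u in (0 : ℝ)..t, Real.cot (x u / 2) :=
    intervalIntegral.continuous_primitive (fun a b ↦ hc.intervalIntegrable a b) 0
  change Continuous fun t ↦ q₀ - (∫ u in (0 : ℝ)..t, Real.cot (x u / 2)) + x t
  exact (continuous_const.sub hprim).add x.continuous

/-- **The force-point phase solves `q̇ = -cot(X/2)`**: along an angle path in `(0, 2π)` the phase
`qₜ = drivingOfAngle q₀ X t - Xₜ = q₀ - ∫₀ᵗ cot(X_u/2) du` is differentiable with derivative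
`-cot(Xₜ/2)` — the second line `dOₜ = Ψ(Wₜ, Oₜ) dt` of the radial SLE_κ(ρ) equation of
Miller–Sheffield (2013), §2.1.2, eq. (2.1), in the angular coordinate `O = e^{iq}`
(Zhan (2021), §3: `dq = -cot₂(X) dt`). [cite: MillerSheffield2013, §2.1.2] -/
theorem hasDerivAt_drivingOfAngle_sub (q₀ : ℝ) (x : C(ℝ, ℝ)) (hx : ∀ t, x t ∈ Ioo 0 (2 * π))
    (t : ℝ) : HasDerivAt (fun s ↦ drivingOfAngle q₀ x s - x s) (-Real.cot (x t / 2)) t := by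
  have hc := continuous_cot_half_path x hx
  have hprim : HasDerivAt (fun s ↦ ∫ u in (0 : ℝ)..s, Real.cot (x u / 2)) (Real.cot (x t / 2)) t :=
    (hc.integral_hasStrictDerivAt 0 t).hasDerivAt
  have : (fun s ↦ drivingOfAngle q₀ x s - x s) = fun s ↦ q₀ - ∫ u in (0 : ℝ)..s, Real.cot (x u / 2) := by
    funext s; simp only [drivingOfAngle]; ring
  rw [this]
  simpa using hprim.const_sub q₀

/-- **Shift covariance of the driving functional**: for an angle path in `(0, 2π)`, shifting time
by `s` turns the driving angle of `(q₀, X)` into that of the evolved phase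
`q_s = q₀ - ∫₀ˢ cot(X_u/2) du` and the shifted path `X(s + ·)`:
`drivingOfAngle q₀ X (s + t) = drivingOfAngle q_s (timeShift s X) t`. This is the identity behind
the time-stationarity of the whole-plane SLE_κ(ρ) driving process used in Miller–Sheffield (2013),
proof of Prop. 2.5 ("the driving function of a whole-plane SLE_κ^μ(ρ) process is
time-stationary"). [folklore] -/
theorem drivingOfAngle_add (q₀ : ℝ) (x : C(ℝ, ℝ)) (hx : ∀ t, x t ∈ Ioo 0 (2 * π)) (s t : ℝ) :
    drivingOfAngle q₀ x (s + t) =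
      drivingOfAngle (q₀ - ∫ u in (0 : ℝ)..s, Real.cot (x u / 2)) (timeShift s x) t := by
  have hc := continuous_cot_half_path x hx
  have hsplit : ∫ u in (0 : ℝ)..(s + t), Real.cot (x u / 2) =
      (∫ u in (0 : ℝ)..s, Real.cot (x u / 2)) + ∫ u in s..(s + t), Real.cot (x u / 2) :=
    (intervalIntegral.integral_add_adjacent_intervals (hc.intervalIntegrable 0 s)
      (hc.intervalIntegrable s (s + t))).symm
  have hshift : ∫ u in (0 : ℝ)..t, Real.cot (timeShift s x u / 2) =
      ∫ u in s..(s + t), Real.cot (x u / 2) := by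
    simp only [timeShift_apply]
    rw [intervalIntegral.integral_comp_add_left (fun u ↦ Real.cot (x u / 2)) s, add_zero]
  simp only [drivingOfAngle]
  rw [hshift, hsplit, timeShift_apply]
  ring

/-- **The driving functional is jointly measurable in the driving data**: for each time `t`,
`(X, q₀) ↦ drivingOfAngle q₀ X t` is measurable on `C(ℝ, ℝ) × ℝ` (evaluation `(X, u) ↦ X u` is
jointly continuous, `cot` is Borel, and a parametric Lebesgue integral of a jointly measurable
integrand is measurable, junk value `0` included — `StronglyMeasurable.integral_prod_right'`), so
the driving process `ω ↦ drivingOfAngle (q₀ ω) (X ω) t` of whole-plane SLE_κ(ρ) is a random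
variable whenever `X` and `q₀` are. [folklore] -/
theorem measurable_drivingOfAngle (t : ℝ) :
    Measurable fun p : C(ℝ, ℝ) × ℝ ↦ drivingOfAngle p.2 p.1 t := by
  have hcot : Measurable Real.cot := by
    have : Real.cot = fun x ↦ Real.cos x / Real.sin x := funext fun x ↦ Real.cot_eq_cos_div_sin x
    rw [this]
    exact Real.measurable_cos.div Real.measurable_sin
  have heval : Measurable fun p : C(ℝ, ℝ) × ℝ ↦ p.1 p.2 :=
    (continuous_eval : Continuous fun p : C(ℝ, ℝ) × ℝ ↦ p.1 p.2).measurable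
  have hF : StronglyMeasurable fun p : C(ℝ, ℝ) × ℝ ↦ Real.cot (p.1 p.2 / 2) :=
    (hcot.comp (heval.div_const _)).stronglyMeasurable
  have hint : ∀ a b : ℝ, Measurable fun x : C(ℝ, ℝ) ↦ ∫ u in Ioc a b, Real.cot (x u / 2) := fun a b ↦
    (hF.integral_prod_right' (ν := volume.restrict (Ioc a b))).measurable
  have hprim : Measurable fun x : C(ℝ, ℝ) ↦ ∫ u in (0 : ℝ)..t, Real.cot (x u / 2) := by
    simp only [intervalIntegral]
    exact (hint 0 t).sub (hint t 0)
  have ht : Measurable fun x : C(ℝ, ℝ) ↦ x t := (continuous_eval_const t).measurable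
  change Measurable fun p : C(ℝ, ℝ) × ℝ ↦ p.2 - (∫ u in (0 : ℝ)..t, Real.cot (p.1 u / 2)) + p.1 t
  exact (measurable_snd.sub (hprim.comp measurable_fst)).add (ht.comp measurable_fst)

/-- For a fixed phase, the driving angle at time `t` is a measurable functional of the angle path.
[folklore] -/
theorem measurable_drivingOfAngle_left (q₀ t : ℝ) :
    Measurable fun x : C(ℝ, ℝ) ↦ drivingOfAngle q₀ x t :=
  (measurable_drivingOfAngle t).comp (measurable_id.prodMk measurable_const)

variable {κ : ℝ≥0} {ρ : ℝ} {P₀ : Measure C(ℝ, ℝ)}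

/-- Under a stationary angle law, for every phase `q₀` the driving angle `drivingOfAngle q₀ X` is
almost surely continuous (the angle a.s. never leaves `(0, 2π)`). [folklore] -/
theorem IsStationaryAngleLaw.ae_continuous_drivingOfAngle (h : IsStationaryAngleLaw κ ρ P₀)
    (q₀ : ℝ) : ∀ᵐ x ∂P₀, Continuous (drivingOfAngle q₀ x) :=
  h.2.1.mono fun x hx ↦ continuous_drivingOfAngle q₀ x hx

/-- Under a stationary angle law, and given the existence of whole-plane Loewner chains for
continuous driving angles (the named fact `WholePlaneLoewnerChain.exists_unique`, hypothesis
`hC`), for every phase `q₀` the whole-plane Loewner chain driven by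
`exp (i · drivingOfAngle q₀ X)` almost surely exists. Miller–Sheffield (2013), §2.1.3
(whole-plane SLE_κ(ρ) "is the growth process associated with" the whole-plane Loewner equation
driven by the stationary solution); Lawler (2005), Prop. 4.21. [cite: MillerSheffield2013, §2.1.3] -/
theorem IsStationaryAngleLaw.ae_nonempty_wholePlaneLoewnerChain (h : IsStationaryAngleLaw κ ρ P₀)
    (hC : WholePlaneLoewnerChain.exists_unique) (q₀ : ℝ) :
    ∀ᵐ x ∂P₀, Nonempty (WholePlaneLoewnerChain (drivingOfAngle q₀ x)) :=
  (h.ae_continuous_drivingOfAngle q₀).mono fun _ hx ↦ (hC _ hx).1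

/-- **Product realisation of the driving data.** On `Ω = C(ℝ, ℝ) × ℝ` with the product measure
`P₀ ⊗ uniformAngleLaw` of a stationary angle law and the uniform phase law, the coordinates
`X = fst`, `q₀ = snd` are independent. [folklore] -/
theorem IsStationaryAngleLaw.indepFun_fst_snd (h : IsStationaryAngleLaw κ ρ P₀) :
    IndepFun (Prod.fst : C(ℝ, ℝ) × ℝ → C(ℝ, ℝ)) (Prod.snd : C(ℝ, ℝ) × ℝ → ℝ)
      (P₀.prod uniformAngleLaw) := by
  haveI := h.isProbabilityMeasure
  exact indepFun_prod (X := id) (Y := id) measurable_id measurable_id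

/-- The first marginal of the product realisation is the angle law. [folklore] -/
theorem IsStationaryAngleLaw.map_fst_prod_uniformAngleLaw (P₀ : Measure C(ℝ, ℝ)) :
    (P₀.prod uniformAngleLaw).map Prod.fst = P₀ := by
  rw [Measure.map_fst_prod, measure_univ, one_smul]

/-- The second marginal of the product realisation is the uniform phase law. [folklore] -/
theorem IsStationaryAngleLaw.map_snd_prod_uniformAngleLaw (h : IsStationaryAngleLaw κ ρ P₀) :
    (P₀.prod uniformAngleLaw).map Prod.snd = uniformAngleLaw := by
  haveI := h.isProbabilityMeasure
  rw [Measure.map_snd_prod, measure_univ, one_smul]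

/-- **Driving data of whole-plane SLE_κ(ρ)** (steps 1–3 of the existence proof, conditional on the
two named facts `IsStationaryAngleLaw.exists_unique` — Miller–Sheffield (2013), Prop. 2.1 — and
`WholePlaneLoewnerChain.exists_unique` — Lawler (2005), Prop. 4.21): in the non-hitting regime
`0 < κ ≤ 2(ρ + 2)` there is a probability space carrying an angle process `X` with the stationary
SLE_κ(ρ) angle law and an independent phase `q₀` uniform on `[0, 2π)` such that, almost surely, the
whole-plane Loewner chain driven by `exp (i · drivingOfAngle q₀ X)` exists (namely
`Ω = C(ℝ, ℝ) × ℝ`, `P = P₀ ⊗ uniformAngleLaw`, coordinates). What `IsWholePlaneSLEKappaRho.exists`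
demands beyond this is Miller–Sheffield (2013), Prop. 2.5: the chain is a.s. generated by a
continuous curve, measurably in `ω`. [cite: MillerSheffield2013, §2.1.3] -/
theorem IsWholePlaneSLEKappaRho.exists_drivingData (hlaw : IsStationaryAngleLaw.exists_unique)
    (hC : WholePlaneLoewnerChain.exists_unique) (κ : ℝ≥0) (ρ : ℝ) (hκ : 0 < κ)
    (hκρ : (κ : ℝ) ≤ 2 * (ρ + 2)) :
    ∃ (Ω : Type) (_ : MeasurableSpace Ω) (P : Measure Ω) (X : Ω → C(ℝ, ℝ)) (q₀ : Ω → ℝ),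
      IsProbabilityMeasure P ∧ Measurable X ∧ Measurable q₀ ∧
        IsStationaryAngleLaw κ ρ (P.map X) ∧ P.map q₀ = uniformAngleLaw ∧ IndepFun X q₀ P ∧
        ∀ᵐ ω ∂P, Nonempty (WholePlaneLoewnerChain (drivingOfAngle (q₀ ω) (X ω))) := by
  obtain ⟨P₀, hP₀, -⟩ := hlaw κ ρ hκ hκρ
  haveI := hP₀.isProbabilityMeasure
  refine ⟨C(ℝ, ℝ) × ℝ, inferInstance, P₀.prod uniformAngleLaw, Prod.fst, Prod.snd, inferInstance,
    measurable_fst, measurable_snd, ?_, hP₀.map_snd_prod_uniformAngleLaw, hP₀.indepFun_fst_snd, ?_⟩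
  · rw [IsStationaryAngleLaw.map_fst_prod_uniformAngleLaw]; exact hP₀
  · have hae : ∀ᵐ x ∂(P₀.prod uniformAngleLaw).map Prod.fst, ∀ t, x t ∈ Ioo 0 (2 * π) := by
      rw [IsStationaryAngleLaw.map_fst_prod_uniformAngleLaw]; exact hP₀.2.1
    exact (ae_of_ae_map measurable_fst.aemeasurable hae).mono fun ω hω ↦
      (hC _ (continuous_drivingOfAngle ω.2 ω.1 hω)).1

end Glue

/-! ### Glue for the curve: from the Markovian description of the hulls to `IsCurve` -/

section CurveGlue

/-- The closed trace `γ[-∞, t] = {a} ∪ γ((-∞, t])` of a two-sided curve with limit `a` at `-∞` is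
compact (it is `{a} ∪ range (u ↦ γ (t - |u|))`, and `t - |u| → -∞` along `cocompact ℝ`).
[folklore] -/
theorem isCompact_insert_image_Iic {γ : ℝ → ℂ} {a : ℂ} (hγ : Continuous γ)
    (h0 : Tendsto γ atBot (𝓝 a)) (t : ℝ) : IsCompact (insert a (γ '' Iic t)) := by
  have hrange : range (γ ∘ fun u : ℝ ↦ t - |u|) = γ '' Iic t := by
    ext z
    constructor
    · rintro ⟨u, rfl⟩
      exact ⟨t - |u|, by simp [abs_nonneg], rfl⟩
    · rintro ⟨s, hs, rfl⟩
      have hs' : 0 ≤ t - s := sub_nonneg.mpr hs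
      exact ⟨t - s, by simp [abs_of_nonneg hs']⟩
  have hlim : Tendsto (fun u : ℝ ↦ t - |u|) (cocompact ℝ) atBot := by
    have h1 : Tendsto (fun u : ℝ ↦ t - |u|) atBot atBot := by
      simpa [sub_eq_add_neg] using
        tendsto_atBot_add_const_left _ t (tendsto_neg_atTop_atBot.comp tendsto_abs_atBot_atTop)
    have h2 : Tendsto (fun u : ℝ ↦ t - |u|) atTop atBot := by
      simpa [sub_eq_add_neg] using
        tendsto_atBot_add_const_left _ t (tendsto_neg_atTop_atBot.comp tendsto_abs_atTop_atTop)
    rw [cocompact_eq_atBot_atTop]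
    exact tendsto_sup.mpr ⟨h1, h2⟩
  have := (h0.comp hlim).isCompact_insert_range_of_cocompact
    (hγ.comp (continuous_const.sub continuous_abs))
  rwa [hrange] at this

namespace WholePlaneLoewnerChain

variable {lam : ℝ → ℝ}

/-- **The hulls shrink to the origin**: every neighbourhood of `0` contains `K_T` for all
sufficiently negative `T` (nested compact sets with `⋂ₜ Kₜ = {0}`). Lawler (2005), §4.3 (there
quantitatively, `K_t ⊆ {|z| ≤ 4eᵗ}` by the Koebe one-quarter theorem). [folklore] -/
theorem eventually_hull_subset (C : WholePlaneLoewnerChain lam) {U : Set ℂ} (hU : U ∈ 𝓝 (0 : ℂ)) :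
    ∀ᶠ T in atBot, C.hull T ⊆ U := by
  have hdir : Directed (· ⊇ ·) C.hull := fun a b ↦
    ⟨min a b, C.hull_mono (min_le_left a b), C.hull_mono (min_le_right a b)⟩
  obtain ⟨T₀, hT₀⟩ := exists_subset_nhds_of_isCompact' hdir C.isCompact_hull
    (fun T ↦ (C.isCompact_hull T).isClosed) (U := U) fun x hx ↦ by
      rw [C.iInter_hull, mem_singleton_iff] at hx
      simpa [hx] using hU
  exact (eventually_le_atBot T₀).mono fun T hT ↦ (C.hull_mono hT).trans hT₀

/-- The hulls are bounded. [folklore] -/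
theorem isBounded_hull (C : WholePlaneLoewnerChain lam) (t : ℝ) : Bornology.IsBounded (C.hull t) :=
  (C.isCompact_hull t).isBounded

/-- The Loewner domain `ℂ ∖ Kₜ` is unbounded. [folklore] -/
theorem not_isBounded_compl_hull (C : WholePlaneLoewnerChain lam) (t : ℝ) :
    ¬ Bornology.IsBounded (C.hull t)ᶜ := fun h ↦
  NormedSpace.unbounded_univ ℝ ℂ (by simpa using (C.isBounded_hull t).union h)

/-- **From the Markovian description of the hulls to `IsCurve`.** Let `C` be a whole-plane Loewner
chain and `γ : ℝ → ℂ` a continuous two-sided path with `γ(t) → 0` as `t → -∞`. If for all `T < t`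
the Loewner domain `ℂ ∖ Kₜ` is the unbounded component of `ℂ ∖ (γ[T, t] ∪ K_T)` — the form in
which Miller–Sheffield (2013), proof of Prop. 2.5, obtain the whole-plane curve from the radial
SLE_κ(ρ) in `ℂ ∖ K_T` ("`Kₜ|_{[T,∞)}` is the complement of the unbounded connected component of
`ℂ ∖ ((1/g_T⁻¹)(η([T,t])) ∪ K_T)`") — then `C` is generated by `γ` in the sense of `IsCurve`:
`ℂ ∖ Kₜ` is the unbounded component of `ℂ ∖ ({0} ∪ γ(-∞, t])`. (A path in the latter set from `z`
towards `∞` keeps a positive distance from `0`, hence avoids `K_T` for `T ≪ 0` by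
`eventually_hull_subset`.) [folklore] -/
theorem isCurve_of_forall_lt (C : WholePlaneLoewnerChain lam) {γ : ℝ → ℂ} (hγ : Continuous γ)
    (h0 : Tendsto γ atBot (𝓝 0))
    (hgen : ∀ T t, T < t →
      (C.hull t)ᶜ = Loewner.unboundedComponent (γ '' Icc T t ∪ C.hull T)ᶜ) :
    C.IsCurve γ := by
  have hγmem : ∀ s, γ s ∈ C.hull s := fun s ↦ by
    by_contra hnot
    have hmem : γ s ∈ Loewner.unboundedComponent (γ '' Icc (s - 1) s ∪ C.hull (s - 1))ᶜ := by
      rw [← hgen (s - 1) s (by linarith)]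
      exact hnot
    exact (Loewner.unboundedComponent_subset _ hmem) (Or.inl ⟨s, ⟨by linarith, le_rfl⟩, rfl⟩)
  refine ⟨hγ, h0, fun t ↦ ?_⟩
  set A : Set ℂ := insert 0 (γ '' Iic t) with hA_def
  have hAK : A ⊆ C.hull t := by
    rintro z (rfl | ⟨s, hs, rfl⟩)
    · exact C.zero_mem t
    · exact C.hull_mono hs (hγmem s)
  have hAc : IsClosed A := (isCompact_insert_image_Iic hγ h0 t).isClosed
  refine Subset.antisymm (fun z hz ↦ ⟨fun hzA ↦ hz (hAK hzA), fun hbdd ↦ ?_⟩) (fun z hz ↦ ?_)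
  · have hsub : (C.hull t)ᶜ ⊆ connectedComponentIn Aᶜ z :=
      (C.isConnected_compl_hull t).isPreconnected.subset_connectedComponentIn hz
        (compl_subset_compl.mpr hAK)
    exact C.not_isBounded_compl_hull t (hbdd.subset hsub)
  · obtain ⟨hzA, hV⟩ := hz
    have hVopen : IsOpen (connectedComponentIn Aᶜ z) := hAc.isOpen_compl.connectedComponentIn
    have hVconn : IsConnected (connectedComponentIn Aᶜ z) :=
      isConnected_connectedComponentIn_iff.mpr hzA
    obtain ⟨w, hwV, hwK⟩ : ∃ w ∈ connectedComponentIn Aᶜ z, w ∉ C.hull t := by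
      by_contra h
      exact hV ((C.isBounded_hull t).subset fun w hw ↦ not_not.mp (fun hwK ↦ h ⟨w, hw, hwK⟩))
    obtain ⟨p, hp⟩ := (hVopen.isConnected_iff_isPathConnected.mp hVconn).joinedIn z
      (mem_connectedComponentIn hzA) w hwV
    have h0p : (0 : ℂ) ∉ range p := by
      rintro ⟨u, hu⟩
      exact (connectedComponentIn_subset _ _ (hp u)) (hu ▸ mem_insert 0 _)
    obtain ⟨ε, hε, hball⟩ : ∃ ε > 0, Metric.ball (0 : ℂ) ε ⊆ (range p)ᶜ :=
      Metric.isOpen_iff.mp (isCompact_range p.continuous).isClosed.isOpen_compl 0 h0p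
    obtain ⟨T₀, hT₀⟩ := (C.eventually_hull_subset (Metric.ball_mem_nhds 0 hε)).exists
    have hTt : min T₀ (t - 1) < t := (min_le_right _ _).trans_lt (by linarith)
    have hKT : C.hull (min T₀ (t - 1)) ⊆ Metric.ball 0 ε := (C.hull_mono (min_le_left _ _)).trans hT₀
    set B : Set ℂ := (γ '' Icc (min T₀ (t - 1)) t ∪ C.hull (min T₀ (t - 1)))ᶜ with hB_def
    have hpB : range p ⊆ B := by
      rintro _ ⟨u, rfl⟩ (hmem | hmem)
      · obtain ⟨s, hs, hsu⟩ := hmem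
        exact (connectedComponentIn_subset _ _ (hp u)) (hsu ▸ mem_insert_of_mem 0 ⟨s, hs.2, rfl⟩)
      · exact hball (hKT hmem) ⟨u, rfl⟩
    have hw : w ∈ Loewner.unboundedComponent B := by
      rw [hB_def, ← hgen _ t hTt]
      exact hwK
    have hzw : z ∈ connectedComponentIn B w :=
      ((isPreconnected_range p.continuous).subset_connectedComponentIn ⟨1, p.target⟩ hpB)
        ⟨0, p.source⟩
    show z ∈ (C.hull t)ᶜ
    rw [hgen _ t hTt]
    refine ⟨hpB ⟨0, p.source⟩, ?_⟩
    rw [← connectedComponentIn_eq hzw]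
    exact hw.2

/-- Off the hull, the Loewner map takes values in the exterior disc `{1 < |z|}`. [folklore] -/
theorem map_mem_exteriorDisc (C : WholePlaneLoewnerChain lam) {t : ℝ} {z : ℂ} (hz : z ∉ C.hull t) :
    C.map t z ∈ exteriorDisc := by
  obtain ⟨φ, hφ⟩ := C.exists_conformalEquiv t
  rw [hφ hz]
  exact φ.mapsTo hz

/-- Off the hull, `1 < |gₜ(z)|`. [folklore] -/
theorem one_lt_norm_map (C : WholePlaneLoewnerChain lam) {t : ℝ} {z : ℂ} (hz : z ∉ C.hull t) :
    1 < ‖C.map t z‖ :=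
  C.map_mem_exteriorDisc hz

/-- Off the hull, `gₜ(z) ≠ 0`. [folklore] -/
theorem map_ne_zero (C : WholePlaneLoewnerChain lam) {t : ℝ} {z : ℂ} (hz : z ∉ C.hull t) :
    C.map t z ≠ 0 := fun h ↦ by
  have := C.one_lt_norm_map hz
  rw [h, norm_zero] at this
  exact absurd this (by norm_num)

/-- Off the hull, `gₜ(z)` is not on the unit circle; in particular `gₜ(z) ≠ W_t = exp (i · lam t)`,
so the whole-plane Loewner vector field is regular there. [folklore] -/
theorem map_ne_exp_mul_I (C : WholePlaneLoewnerChain lam) {t : ℝ} {z : ℂ} (hz : z ∉ C.hull t)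
    (θ : ℝ) : C.map t z ≠ exp (θ * I) := fun h ↦ by
  have := C.one_lt_norm_map hz
  rw [h, norm_exp_ofReal_mul_I] at this
  exact lt_irrefl _ this

/-- **Whole-plane to radial change of coordinates** (deterministic part of "whole-plane SLE is a
bi-infinite radial SLE"): if `s ↦ gₛ(z)` solves the whole-plane Loewner equation
`ġ = g (W + g)/(W - g)`, `W = exp (i·lam)`, at a point `z ∉ Kₜ`, then `hₛ = 1/gₛ(z) ∈ 𝔻` solves
at `s = t` the *radial* Loewner equation in the unit disc driven by the conjugate point
`W̄ = exp (-i·lam)`: `ḣ = h (W̄ + h)/(W̄ - h)`, i.e. the same vector field with driving angle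
`-lam`. Miller–Sheffield (2013), §2.1.3 ("for any `s ∈ ℝ`, the growth process
`1/g_s(K_t ∖ K_s)` … from `∂𝔻` to `0` is a radial SLE_κ process in `𝔻`. Thus, whole-plane SLE
can be thought of as a bi-infinite time version of radial SLE"). [cite: MillerSheffield2013, §2.1.3] -/
theorem hasDerivAt_inv_map (C : WholePlaneLoewnerChain lam) {t : ℝ} {z : ℂ} (hz : z ∉ C.hull t) :
    HasDerivAt (fun s ↦ (C.map s z)⁻¹)
      (WholePlaneLoewner.field (fun s ↦ -lam s) t (C.map t z)⁻¹) t := by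
  have hg0 : C.map t z ≠ 0 := C.map_ne_zero hz
  have hW : C.map t z ≠ exp (lam t * I) := C.map_ne_exp_mul_I hz (lam t)
  have hd : HasDerivAt (fun s ↦ (C.map s z)⁻¹)
      (-(WholePlaneLoewner.field lam t (C.map t z)) / (C.map t z) ^ 2) t :=
    (C.hasDerivAt t z hz).inv hg0
  refine hd.congr_deriv ?_
  have hsub : exp (lam t * I) - C.map t z ≠ 0 := sub_ne_zero.mpr (Ne.symm hW)
  have hexp : exp (↑(-lam t) * I) = (exp (lam t * I))⁻¹ := by
    rw [← exp_neg]
    push_cast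
    ring_nf
  have hsub' : (exp (lam t * I))⁻¹ - (C.map t z)⁻¹ ≠ 0 := by
    rw [sub_ne_zero, Ne, inv_inj]
    exact fun h ↦ hW h.symm
  rw [WholePlaneLoewner.field_apply, WholePlaneLoewner.field_apply, hexp]
  field_simp
  ring

end WholePlaneLoewnerChain

end CurveGlue

/-! ### Uniqueness of the whole-plane Loewner chain (Lawler (2005), Prop. 4.21, uniqueness) -/

section Unique

open Metric

namespace WholePlaneLoewner

/-- **Difference identity for the whole-plane Loewner field**: for `w, w' ≠ W = exp (i·lam t)`,
`V(w) - V(w') = (w - w') (W² + W (w + w') - w w') / ((W - w)(W - w'))`. [folklore] -/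
theorem field_sub_field (lam : ℝ → ℝ) (t : ℝ) {w w' : ℂ} (hw : w ≠ exp (lam t * I))
    (hw' : w' ≠ exp (lam t * I)) :
    field lam t w - field lam t w' =
      (w - w') * (exp (lam t * I) ^ 2 + exp (lam t * I) * (w + w') - w * w') /
        ((exp (lam t * I) - w) * (exp (lam t * I) - w')) := by
  have h1 : exp (lam t * I) - w ≠ 0 := sub_ne_zero.mpr (Ne.symm hw)
  have h2 : exp (lam t * I) - w' ≠ 0 := sub_ne_zero.mpr (Ne.symm hw')
  rw [field_apply, field_apply, div_sub_div _ _ h1 h2, mul_comm (exp (lam t * I) - w) (exp (lam t * I) - w')]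
  congr 1
  ring

/-- **Local Lipschitz bound for the whole-plane Loewner field**: on `{|w| ≤ R, δ ≤ |W - w|}` the
field is `(1 + R)²/δ²`-Lipschitz. [folklore] -/
theorem norm_field_sub_field_le (lam : ℝ → ℝ) (t : ℝ) {w w' : ℂ} {R δ : ℝ} (hδ : 0 < δ)
    (hw : ‖w‖ ≤ R) (hw' : ‖w'‖ ≤ R) (hdw : δ ≤ ‖exp (lam t * I) - w‖)
    (hdw' : δ ≤ ‖exp (lam t * I) - w'‖) :
    ‖field lam t w - field lam t w'‖ ≤ (1 + R) ^ 2 / δ ^ 2 * ‖w - w'‖ := by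
  have hR : 0 ≤ R := (norm_nonneg w).trans hw
  have hne : w ≠ exp (lam t * I) := fun h ↦ by
    rw [h, sub_self, norm_zero] at hdw; exact absurd hdw (not_le.mpr hδ)
  have hne' : w' ≠ exp (lam t * I) := fun h ↦ by
    rw [h, sub_self, norm_zero] at hdw'; exact absurd hdw' (not_le.mpr hδ)
  rw [field_sub_field lam t hne hne', norm_div, norm_mul, norm_mul]
  have hnum : ‖exp (lam t * I) ^ 2 + exp (lam t * I) * (w + w') - w * w'‖ ≤ (1 + R) ^ 2 := by
    have hE : ‖exp (lam t * I)‖ = 1 := norm_exp_ofReal_mul_I _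
    calc ‖exp (lam t * I) ^ 2 + exp (lam t * I) * (w + w') - w * w'‖
        ≤ ‖exp (lam t * I) ^ 2 + exp (lam t * I) * (w + w')‖ + ‖w * w'‖ := norm_sub_le _ _
      _ ≤ ‖exp (lam t * I) ^ 2‖ + ‖exp (lam t * I) * (w + w')‖ + ‖w * w'‖ := by
          gcongr; exact norm_add_le _ _
      _ ≤ 1 + (R + R) + R * R := by
          rw [norm_pow, norm_mul, norm_mul, hE, one_pow, one_mul]
          gcongr
          exact (norm_add_le _ _).trans (add_le_add hw hw')
      _ = (1 + R) ^ 2 := by ring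
  have hden : δ ^ 2 ≤ ‖exp (lam t * I) - w‖ * ‖exp (lam t * I) - w'‖ := by
    rw [sq]; exact mul_le_mul hdw hdw' hδ.le (norm_nonneg _)
  have hδ2 : 0 < δ ^ 2 := by positivity
  rw [div_le_iff₀ (hδ2.trans_le hden)]
  calc ‖w - w'‖ * ‖exp (lam t * I) ^ 2 + exp (lam t * I) * (w + w') - w * w'‖
      ≤ ‖w - w'‖ * (1 + R) ^ 2 := by gcongr
    _ = (1 + R) ^ 2 / δ ^ 2 * ‖w - w'‖ * δ ^ 2 := by field_simp
    _ ≤ (1 + R) ^ 2 / δ ^ 2 * ‖w - w'‖ * (‖exp (lam t * I) - w‖ * ‖exp (lam t * I) - w'‖) := by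
        gcongr

/-- **The `eˢ`-rescaled field**: `w + V(w) = 2 W w / (W - w)`, so that `u = eˢ gₛ` solves
`u̇ = 2 W u / (W - g)`. Lawler (2005), proof of Prop. 4.21. [folklore] -/
theorem add_field (lam : ℝ → ℝ) (t : ℝ) {w : ℂ} (hw : w ≠ exp (lam t * I)) :
    w + field lam t w = 2 * exp (lam t * I) * w / (exp (lam t * I) - w) := by
  have h1 : exp (lam t * I) - w ≠ 0 := sub_ne_zero.mpr (Ne.symm hw)
  rw [field_apply, eq_div_iff h1]
  field_simp
  ring

/-- Difference of the rescaled fields along two trajectories with the same scale factor `c`: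
`c (w + V w) - c (w' + V w') = 2 W² (c w - c w') / ((W - w)(W - w'))` — the cross terms cancel.
[folklore] -/
theorem rescaled_sub (lam : ℝ → ℝ) (t : ℝ) (c : ℂ) {w w' : ℂ} (hw : w ≠ exp (lam t * I))
    (hw' : w' ≠ exp (lam t * I)) :
    c * (w + field lam t w) - c * (w' + field lam t w') =
      2 * exp (lam t * I) ^ 2 * (c * w - c * w') / ((exp (lam t * I) - w) * (exp (lam t * I) - w')) := by
  have h1 : exp (lam t * I) - w ≠ 0 := sub_ne_zero.mpr (Ne.symm hw)
  have h2 : exp (lam t * I) - w' ≠ 0 := sub_ne_zero.mpr (Ne.symm hw')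
  rw [add_field lam t hw, add_field lam t hw', eq_div_iff (mul_ne_zero h1 h2)]
  field_simp
  ring

end WholePlaneLoewner

namespace WholePlaneLoewnerChain

variable {lam : ℝ → ℝ}

/-- A point off the hull at time `t` is off the hull at every earlier time. [folklore] -/
theorem notMem_hull_of_le (C : WholePlaneLoewnerChain lam) {s t : ℝ} (hst : s ≤ t) {z : ℂ}
    (hz : z ∉ C.hull t) : z ∉ C.hull s :=
  fun h ↦ hz (C.hull_mono hst h)

/-- A point off a hull is not the origin. [folklore] -/
theorem ne_zero_of_notMem_hull (C : WholePlaneLoewnerChain lam) {t : ℝ} {z : ℂ}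
    (hz : z ∉ C.hull t) : z ≠ 0 :=
  fun h ↦ hz (h ▸ C.zero_mem t)

/-- The Loewner trajectory `s ↦ gₛ(z)` of a point `z ∉ Kₜ` is continuous on `(-∞, t]`. [folklore] -/
theorem continuousOn_map_Iic (C : WholePlaneLoewnerChain lam) {t : ℝ} {z : ℂ} (hz : z ∉ C.hull t) :
    ContinuousOn (fun s ↦ C.map s z) (Iic t) := fun s hs ↦
  (C.hasDerivAt s z (C.notMem_hull_of_le hs hz)).continuousAt.continuousWithinAt

/-- **The rescaled trajectory** `uₛ = eˢ gₛ(z)` solves `u̇ = eˢ (g + V(g)) = 2 W u/(W - g)`.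
Lawler (2005), proof of Prop. 4.21. [folklore] -/
theorem hasDerivAt_exp_mul_map (C : WholePlaneLoewnerChain lam) {s : ℝ} {z : ℂ}
    (hz : z ∉ C.hull s) :
    HasDerivAt (fun r ↦ (Real.exp r : ℂ) * C.map r z)
      ((Real.exp s : ℂ) * (C.map s z + WholePlaneLoewner.field lam s (C.map s z))) s := by
  have h1 : HasDerivAt (fun r : ℝ ↦ (Real.exp r : ℂ)) (Real.exp s : ℂ) s :=
    (Real.hasDerivAt_exp s).ofReal_comp
  exact (h1.mul (C.hasDerivAt s z hz)).congr_deriv (by ring)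

/-- Norm of the rescaling. [folklore] -/
theorem norm_ofReal_exp_mul (s : ℝ) (w : ℂ) : ‖(Real.exp s : ℂ) * w‖ = Real.exp s * ‖w‖ := by
  rw [norm_mul, Complex.norm_real, Real.norm_of_nonneg (Real.exp_pos s).le]

/-- **The contraction estimate near `t = -∞`** (real-analysis core of the uniqueness proof): if
`|v| = 1`, `e ≤ |z|/8` and the rescaled points `e w`, `e w'` are within `|z|/2` of `z ≠ 0`, then
`|2 v² (e w - e w') / ((v - w)(v - w'))| ≤ 32 e²/|z|² · |e w - e w'|` (because
`|v - w|, |v - w'| ≥ |z|/(4e)`). [folklore] -/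
theorem norm_rescaled_deriv_le {v w w' z : ℂ} {e : ℝ} (he : 0 < e) (hv : ‖v‖ = 1)
    (hz : 0 < ‖z‖) (hez : e ≤ ‖z‖ / 8) (hw : ‖(e : ℂ) * w - z‖ ≤ ‖z‖ / 2)
    (hw' : ‖(e : ℂ) * w' - z‖ ≤ ‖z‖ / 2) :
    ‖2 * v ^ 2 * ((e : ℂ) * w - (e : ℂ) * w') / ((v - w) * (v - w'))‖ ≤
      32 * (e * e) / ‖z‖ ^ 2 * ‖(e : ℂ) * w - (e : ℂ) * w'‖ := by
  -- lower bound for `‖v - x‖` when `e x` is close to `z`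
  have key : ∀ {x : ℂ}, ‖(e : ℂ) * x - z‖ ≤ ‖z‖ / 2 → ‖z‖ / (4 * e) ≤ ‖v - x‖ := by
    intro x hx
    have hex : ‖(e : ℂ) * x‖ = e * ‖x‖ := by rw [norm_mul, Complex.norm_of_nonneg he.le]
    have h1 : ‖z‖ / 2 ≤ e * ‖x‖ := by
      have h := norm_sub_norm_le z ((e : ℂ) * x)
      rw [norm_sub_rev] at hx
      rw [hex] at h
      linarith
    have hx_lb : ‖z‖ / (2 * e) ≤ ‖x‖ := by
      rw [div_le_iff₀ (by positivity)]; linarith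
    have hone : (1 : ℝ) ≤ ‖z‖ / (8 * e) := by
      rw [le_div_iff₀ (by positivity)]; linarith
    have hq : ‖z‖ / (4 * e) = ‖z‖ / (2 * e) - 2 * (‖z‖ / (8 * e)) := by
      field_simp; ring
    calc ‖z‖ / (4 * e) ≤ ‖x‖ - 1 := by rw [hq]; linarith
      _ = ‖x‖ - ‖v‖ := by rw [hv]
      _ ≤ ‖x - v‖ := norm_sub_norm_le x v
      _ = ‖v - x‖ := norm_sub_rev x v
  have hA := key hw
  have hB := key hw'
  have hq0 : 0 < ‖z‖ / (4 * e) := by positivity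
  have hnorm : ‖2 * v ^ 2 * ((e : ℂ) * w - (e : ℂ) * w') / ((v - w) * (v - w'))‖ =
      2 * ‖(e : ℂ) * w - (e : ℂ) * w'‖ / (‖v - w‖ * ‖v - w'‖) := by
    rw [norm_div, norm_mul, norm_mul, norm_mul, norm_pow, hv, one_pow, mul_one, Complex.norm_two]
  rw [hnorm, div_le_iff₀ (mul_pos (hq0.trans_le hA) (hq0.trans_le hB))]
  calc 2 * ‖(e : ℂ) * w - (e : ℂ) * w'‖
      = 32 * (e * e) / ‖z‖ ^ 2 * ‖(e : ℂ) * w - (e : ℂ) * w'‖ *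
          (‖z‖ / (4 * e) * (‖z‖ / (4 * e))) := by
        field_simp
        ring
    _ ≤ 32 * (e * e) / ‖z‖ ^ 2 * ‖(e : ℂ) * w - (e : ℂ) * w'‖ * (‖v - w‖ * ‖v - w'‖) := by
        gcongr

/-- **Pointwise uniqueness of the whole-plane Loewner trajectories** (Lawler (2005), Prop. 4.21,
uniqueness half; no continuity of the driving angle is needed): two whole-plane Loewner chains
with the same driving angle have the same Loewner map at every point off both hulls. Proof: the
rescaled trajectories `uₛ = eˢ gₛ(z)`, `u'ₛ = eˢ g'ₛ(z)` both tend to `z` as `s → -∞` and their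
difference `d` satisfies `|ḋ| ≤ 32 e^{2s}|z|⁻² |d|` for `s ≪ 0` (`norm_rescaled_deriv_le`), an
integrable rate, so `d ≡ 0` near `-∞` (a maximum argument on `[a, s₁]` and `a → -∞`); forward in
time the field is locally Lipschitz (`WholePlaneLoewner.norm_field_sub_field_le`) and Grönwall's
inequality propagates the equality up to time `t`. [cite: Lawler2005, Prop. 4.21] -/
theorem map_eq_of_notMem_hull (C C' : WholePlaneLoewnerChain lam) {t : ℝ} {z : ℂ}
    (hz : z ∉ C.hull t) (hz' : z ∉ C'.hull t) : C.map t z = C'.map t z := by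
  have hz0 : z ≠ 0 := C.ne_zero_of_notMem_hull hz
  have hzpos : 0 < ‖z‖ := norm_pos_iff.mpr hz0
  have hzs : ∀ {s}, s ≤ t → z ∉ C.hull s := fun hs ↦ C.notMem_hull_of_le hs hz
  have hzs' : ∀ {s}, s ≤ t → z ∉ C'.hull s := fun hs ↦ C'.notMem_hull_of_le hs hz'
  have hWnorm : ∀ s, ‖exp (lam s * I)‖ = 1 := fun s ↦ norm_exp_ofReal_mul_I (lam s)
  -- the rescaled difference `d` and its derivative `D`
  set d : ℝ → ℂ := fun s ↦ (Real.exp s : ℂ) * C.map s z - (Real.exp s : ℂ) * C'.map s z with hd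
  set D : ℝ → ℂ := fun s ↦ 2 * exp (lam s * I) ^ 2 *
      ((Real.exp s : ℂ) * C.map s z - (Real.exp s : ℂ) * C'.map s z) /
        ((exp (lam s * I) - C.map s z) * (exp (lam s * I) - C'.map s z)) with hD
  have hderiv : ∀ s ≤ t, HasDerivAt d (D s) s := fun s hs ↦
    ((C.hasDerivAt_exp_mul_map (hzs hs)).sub (C'.hasDerivAt_exp_mul_map (hzs' hs))).congr_deriv
      (WholePlaneLoewner.rescaled_sub lam s _ (C.map_ne_exp_mul_I (hzs hs) _)
        (C'.map_ne_exp_mul_I (hzs' hs) _))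
  have hexpc : Continuous fun s : ℝ ↦ (Real.exp s : ℂ) := continuous_ofReal.comp Real.continuous_exp
  have hdcont : ContinuousOn d (Iic t) :=
    (hexpc.continuousOn.mul (C.continuousOn_map_Iic hz)).sub
      (hexpc.continuousOn.mul (C'.continuousOn_map_Iic hz'))
  -- Step 0: the asymptotic regime `s ≤ s₀`
  have hlim_u : Tendsto (fun s ↦ (Real.exp s : ℂ) * C.map s z) atBot (𝓝 z) := C.tendsto_atBot z hz0
  have hlim_u' : Tendsto (fun s ↦ (Real.exp s : ℂ) * C'.map s z) atBot (𝓝 z) :=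
    C'.tendsto_atBot z hz0
  have hlim_d : Tendsto d atBot (𝓝 0) := by
    have h := hlim_u.sub hlim_u'
    rwa [sub_self] at h
  obtain ⟨s₀, hs₀⟩ : ∃ s₀, ∀ s ≤ s₀, ‖(Real.exp s : ℂ) * C.map s z - z‖ ≤ ‖z‖ / 2 ∧
      ‖(Real.exp s : ℂ) * C'.map s z - z‖ ≤ ‖z‖ / 2 ∧ Real.exp s ≤ ‖z‖ / 8 := by
    have e1 : ∀ᶠ s in atBot, ‖(Real.exp s : ℂ) * C.map s z - z‖ ≤ ‖z‖ / 2 :=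
      ((Metric.tendsto_nhds.mp hlim_u) (‖z‖ / 2) (by positivity)).mono fun s hs ↦ by
        rw [dist_eq_norm] at hs; exact hs.le
    have e2 : ∀ᶠ s in atBot, ‖(Real.exp s : ℂ) * C'.map s z - z‖ ≤ ‖z‖ / 2 :=
      ((Metric.tendsto_nhds.mp hlim_u') (‖z‖ / 2) (by positivity)).mono fun s hs ↦ by
        rw [dist_eq_norm] at hs; exact hs.le
    have e3 : ∀ᶠ s in atBot, Real.exp s ≤ ‖z‖ / 8 :=
      Real.tendsto_exp_atBot.eventually (eventually_le_nhds (by positivity))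
    exact eventually_atBot.mp (e1.and (e2.and e3))
  -- Step 1: the derivative bound in the asymptotic regime
  have hDbound : ∀ s ≤ s₀, s ≤ t →
      ‖D s‖ ≤ 32 * (Real.exp s * Real.exp s) / ‖z‖ ^ 2 * ‖d s‖ := fun s hs hst ↦
    norm_rescaled_deriv_le (Real.exp_pos s) (hWnorm s) hzpos (hs₀ s hs).2.2 (hs₀ s hs).1
      (hs₀ s hs).2.1
  -- Step 2: a maximum argument on `[a, s₁]`, `s₁ = min s₀ t`
  set s₁ := min s₀ t with hs₁
  have hs₁t : s₁ ≤ t := min_le_right _ _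
  have hs₁0 : s₁ ≤ s₀ := min_le_left _ _
  have hbound2 : ∀ a ≤ s₁, ∀ x ∈ Icc a s₁, ‖d x‖ ≤ 2 * ‖d a‖ := by
    intro a ha x hx
    have hcont : ContinuousOn d (Icc a s₁) := hdcont.mono fun y hy ↦ hy.2.trans hs₁t
    obtain ⟨xm, hxm, hmax⟩ := isCompact_Icc.exists_isMaxOn (nonempty_Icc.mpr ha)
      (continuous_norm.comp_continuousOn hcont)
    have hm_ub : ∀ y ∈ Icc a s₁, ‖d y‖ ≤ ‖d xm‖ := fun y hy ↦ isMaxOn_iff.mp hmax y hy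
    have hm0 : 0 ≤ ‖d xm‖ := norm_nonneg _
    have hB : ∀ x, HasDerivAt
        (fun x ↦ 16 * ‖d xm‖ * (Real.exp x * Real.exp x - Real.exp a * Real.exp a) / ‖z‖ ^ 2)
        (16 * ‖d xm‖ * (Real.exp x * Real.exp x + Real.exp x * Real.exp x) / ‖z‖ ^ 2) x := by
      intro x
      have h := ((Real.hasDerivAt_exp x).mul (Real.hasDerivAt_exp x)).sub_const
        (Real.exp a * Real.exp a)
      exact (h.const_mul (16 * ‖d xm‖)).div_const (‖z‖ ^ 2)
    have hest := image_norm_le_of_norm_deriv_right_le_deriv_boundary (f := fun x ↦ d x - d a)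
      (f' := D) (a := a) (b := s₁) (hcont.sub continuousOn_const)
      (fun x hx ↦ ((hderiv x (hx.2.le.trans hs₁t)).sub_const (d a)).hasDerivWithinAt)
      (by simp) hB
      (fun x hx ↦ by
        have hx0 : x ≤ s₀ := hx.2.le.trans hs₁0
        have hxt : x ≤ t := hx.2.le.trans hs₁t
        calc ‖D x‖ ≤ 32 * (Real.exp x * Real.exp x) / ‖z‖ ^ 2 * ‖d x‖ := hDbound x hx0 hxt
          _ ≤ 32 * (Real.exp x * Real.exp x) / ‖z‖ ^ 2 * ‖d xm‖ := by
              gcongr; exact hm_ub x (Ico_subset_Icc_self hx)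
          _ = 16 * ‖d xm‖ * (Real.exp x * Real.exp x + Real.exp x * Real.exp x) / ‖z‖ ^ 2 := by
              ring)
    have hquarter : ∀ y ∈ Icc a s₁, ‖d y - d a‖ ≤ ‖d xm‖ / 4 := by
      intro y hy
      have hy0 : Real.exp y ≤ ‖z‖ / 8 := (hs₀ y (hy.2.trans hs₁0)).2.2
      have hey : 0 < Real.exp y := Real.exp_pos y
      have hea : 0 < Real.exp a := Real.exp_pos a
      calc ‖d y - d a‖
          ≤ 16 * ‖d xm‖ * (Real.exp y * Real.exp y - Real.exp a * Real.exp a) / ‖z‖ ^ 2 := hest hy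
        _ ≤ 16 * ‖d xm‖ * (Real.exp y * Real.exp y) / ‖z‖ ^ 2 := by
            gcongr; nlinarith
        _ ≤ 16 * ‖d xm‖ * (‖z‖ / 8 * (‖z‖ / 8)) / ‖z‖ ^ 2 := by gcongr
        _ = ‖d xm‖ / 4 := by field_simp; ring
    have hm_le : ‖d xm‖ ≤ 2 * ‖d a‖ := by
      have h1 := norm_sub_norm_le (d xm) (d a)
      have h2 := hquarter xm hxm
      linarith
    exact (hm_ub x hx).trans hm_le
  -- Step 3: `d = 0` on `(-∞, s₁]`, letting `a → -∞`
  have hd0 : ∀ x ≤ s₁, d x = 0 := by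
    intro x hx
    refine norm_eq_zero.mp (le_antisymm (le_of_forall_pos_le_add fun ε hε ↦ ?_) (norm_nonneg _))
    have hev : ∀ᶠ a in atBot, ‖d a‖ < ε / 2 :=
      ((Metric.tendsto_nhds.mp hlim_d) (ε / 2) (by positivity)).mono fun a ha ↦ by
        simpa [dist_zero_right] using ha
    obtain ⟨a, ha⟩ := (hev.and (eventually_le_atBot x)).exists
    have := hbound2 a (ha.2.trans hx) x ⟨ha.2, hx⟩
    linarith [ha.1]
  have hg_eq : ∀ x ≤ s₁, C.map x z = C'.map x z := fun x hx ↦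
    mul_left_cancel₀ (ofReal_ne_zero.mpr (Real.exp_pos x).ne') (sub_eq_zero.mp (hd0 x hx))
  -- Step 4: forward in time on `[s₁, t]` by Grönwall
  have hgc : ContinuousOn (fun s ↦ C.map s z) (Icc s₁ t) :=
    (C.continuousOn_map_Iic hz).mono Icc_subset_Iic_self
  have hgc' : ContinuousOn (fun s ↦ C'.map s z) (Icc s₁ t) :=
    (C'.continuousOn_map_Iic hz').mono Icc_subset_Iic_self
  obtain ⟨R₁, hR₁⟩ := isCompact_Icc.exists_bound_of_continuousOn hgc
  obtain ⟨R₂, hR₂⟩ := isCompact_Icc.exists_bound_of_continuousOn hgc'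
  obtain ⟨sm, hsm, hmin⟩ := isCompact_Icc.exists_isMinOn (nonempty_Icc.mpr hs₁t)
    (continuous_norm.comp_continuousOn hgc)
  obtain ⟨sm', hsm', hmin'⟩ := isCompact_Icc.exists_isMinOn (nonempty_Icc.mpr hs₁t)
    (continuous_norm.comp_continuousOn hgc')
  set δ := min (‖C.map sm z‖ - 1) (‖C'.map sm' z‖ - 1) with hδ
  have hδpos : 0 < δ := lt_min (sub_pos.mpr (C.one_lt_norm_map (hzs hsm.2)))
    (sub_pos.mpr (C'.one_lt_norm_map (hzs' hsm'.2)))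
  have hδW : ∀ s ∈ Icc s₁ t, δ ≤ ‖exp (lam s * I) - C.map s z‖ := by
    intro s hs
    have h1 : ‖C.map sm z‖ ≤ ‖C.map s z‖ := isMinOn_iff.mp hmin s hs
    calc δ ≤ ‖C.map sm z‖ - 1 := min_le_left _ _
      _ ≤ ‖C.map s z‖ - ‖exp (lam s * I)‖ := by rw [hWnorm]; linarith
      _ ≤ ‖C.map s z - exp (lam s * I)‖ := norm_sub_norm_le _ _
      _ = ‖exp (lam s * I) - C.map s z‖ := norm_sub_rev _ _
  have hδW' : ∀ s ∈ Icc s₁ t, δ ≤ ‖exp (lam s * I) - C'.map s z‖ := by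
    intro s hs
    have h1 : ‖C'.map sm' z‖ ≤ ‖C'.map s z‖ := isMinOn_iff.mp hmin' s hs
    calc δ ≤ ‖C'.map sm' z‖ - 1 := min_le_right _ _
      _ ≤ ‖C'.map s z‖ - ‖exp (lam s * I)‖ := by rw [hWnorm]; linarith
      _ ≤ ‖C'.map s z - exp (lam s * I)‖ := norm_sub_norm_le _ _
      _ = ‖exp (lam s * I) - C'.map s z‖ := norm_sub_rev _ _
  have hgr := norm_le_gronwallBound_of_norm_deriv_right_le
    (f := fun s ↦ C.map s z - C'.map s z)
    (f' := fun s ↦ WholePlaneLoewner.field lam s (C.map s z) -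
      WholePlaneLoewner.field lam s (C'.map s z))
    (δ := 0) (K := (1 + max R₁ R₂) ^ 2 / δ ^ 2) (ε := 0) (a := s₁) (b := t) (hgc.sub hgc')
    (fun s hs ↦ ((C.hasDerivAt s z (hzs hs.2.le)).sub (C'.hasDerivAt s z (hzs' hs.2.le))).hasDerivWithinAt)
    (by simp [hg_eq s₁ le_rfl])
    (fun s hs ↦ by
      rw [add_zero]
      exact WholePlaneLoewner.norm_field_sub_field_le lam s hδpos
        ((hR₁ s (Ico_subset_Icc_self hs)).trans (le_max_left _ _))
        ((hR₂ s (Ico_subset_Icc_self hs)).trans (le_max_right _ _))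
        (hδW s (Ico_subset_Icc_self hs)) (hδW' s (Ico_subset_Icc_self hs)))
  have ht := hgr t ⟨hs₁t, le_rfl⟩
  rw [gronwallBound_ε0_δ0] at ht
  exact sub_eq_zero.mp (norm_le_zero_iff.mp ht)

/-- The exterior disc `{1 < |z|}` is open. [folklore] -/
theorem _root_.Literature.Probability.RandomPlanarGeometry.isOpen_exteriorDisc :
    IsOpen exteriorDisc :=
  isOpen_lt continuous_const continuous_norm

/-- The exterior disc `{1 < |z|}` is preconnected (it is the polar-coordinate image of
`(1, ∞) × ℝ`). [folklore] -/
theorem _root_.Literature.Probability.RandomPlanarGeometry.isPreconnected_exteriorDisc :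
    IsPreconnected exteriorDisc := by
  have himage : (fun p : ℝ × ℝ ↦ (p.1 : ℂ) * exp (p.2 * I)) '' Ioi (1 : ℝ) ×ˢ (univ : Set ℝ) =
      exteriorDisc := by
    ext w
    constructor
    · rintro ⟨⟨r, θ⟩, ⟨hr, -⟩, rfl⟩
      have hr' : (1 : ℝ) < r := hr
      show 1 < ‖(r : ℂ) * exp (θ * I)‖
      rwa [norm_mul, norm_exp_ofReal_mul_I, mul_one, Complex.norm_of_nonneg (zero_le_one.trans hr'.le)]
    · intro hw
      exact ⟨(‖w‖, arg w), ⟨hw, mem_univ _⟩, norm_mul_exp_arg_mul_I w⟩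
  rw [← himage]
  exact (isPreconnected_Ioi.prod isPreconnected_univ).image _
    ((continuous_ofReal.comp continuous_fst).mul (Complex.continuous_exp.comp
      ((continuous_ofReal.comp continuous_snd).mul continuous_const))).continuousOn

/-- **Uniqueness of the whole-plane Loewner chain** (Lawler (2005), Prop. 4.21, uniqueness half —
the second clause of the named fact `WholePlaneLoewnerChain.exists_unique`, here for *every*
driving angle, continuous or not): two whole-plane Loewner chains driven by the same `exp (i·lam)`
have the same hulls and the same Loewner maps off the hulls. Proof: off both hulls the maps agree
(`map_eq_of_notMem_hull`), in particular on an exterior region `{R < |z|}`; hence the inverse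
uniformizers `𝔻* → ℂ ∖ Kₜ`, `𝔻* → ℂ ∖ K'ₜ` are holomorphic on the connected open set `𝔻*` and
agree near a point, so they coincide (identity theorem) and so do their images `ℂ ∖ Kₜ = ℂ ∖ K'ₜ`.
[cite: Lawler2005, Prop. 4.21] -/
theorem unique (C C' : WholePlaneLoewnerChain lam) (t : ℝ) :
    C.hull t = C'.hull t ∧ EqOn (C.map t) (C'.map t) (C.hull t)ᶜ := by
  -- hull equality gives the map clause by pointwise uniqueness
  suffices hK : C.hull t = C'.hull t from
    ⟨hK, fun x hx ↦ C.map_eq_of_notMem_hull C' hx (hK ▸ hx)⟩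
  obtain ⟨φ, hφ⟩ := C.exists_conformalEquiv t
  obtain ⟨φ', hφ'⟩ := C'.exists_conformalEquiv t
  -- an exterior region outside both hulls, and a point in it
  obtain ⟨r, hr⟩ := (C.isBounded_hull t).subset_closedBall 0
  obtain ⟨r', hr'⟩ := (C'.isBounded_hull t).subset_closedBall 0
  set A : Set ℂ := (closedBall (0 : ℂ) (max r r'))ᶜ with hA
  have hAK : A ⊆ (C.hull t)ᶜ := compl_subset_compl.mpr (hr.trans (closedBall_subset_closedBall (le_max_left _ _)))
  have hAK' : A ⊆ (C'.hull t)ᶜ := compl_subset_compl.mpr (hr'.trans (closedBall_subset_closedBall (le_max_right _ _)))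
  have hAopen : IsOpen A := isClosed_closedBall.isOpen_compl
  obtain ⟨x₀, hx₀⟩ := NormedSpace.exists_lt_norm ℝ ℂ (max r r')
  have hx₀A : x₀ ∈ A := by simpa [hA, mem_closedBall_zero_iff] using hx₀
  -- the inverse uniformizers agree near `w₀ = φ x₀`
  have hw₀ : φ x₀ ∈ exteriorDisc := φ.mapsTo (hAK hx₀A)
  have hagree : ∀ w ∈ exteriorDisc, φ.symm w ∈ A → φ.symm w = φ'.symm w := by
    intro w hw hwA
    have hxD : φ.symm w ∈ (C.hull t)ᶜ := hAK hwA
    have hxD' : φ.symm w ∈ (C'.hull t)ᶜ := hAK' hwA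
    have h1 : C'.map t (φ.symm w) = w := by
      rw [← C.map_eq_of_notMem_hull C' hxD hxD', hφ hxD, φ.apply_symm_apply hw]
    rw [hφ' hxD'] at h1
    rw [← h1, φ'.symm_apply_apply hxD', h1]
  have hnhds : ∀ᶠ w in 𝓝 (φ x₀), φ.symm w = φ'.symm w := by
    have hE : exteriorDisc ∈ 𝓝 (φ x₀) := isOpen_exteriorDisc.mem_nhds hw₀
    have hcont : ContinuousAt φ.symm (φ x₀) := φ.symm.continuousOn.continuousAt hE
    have hpre : {w | φ.symm w ∈ A} ∈ 𝓝 (φ x₀) := by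
      refine hcont.preimage_mem_nhds (hAopen.mem_nhds ?_)
      rwa [φ.symm_apply_apply (hAK hx₀A)]
    filter_upwards [hE, hpre] with w hw hwA using hagree w hw hwA
  -- identity theorem on the exterior disc
  have han : AnalyticOnNhd ℂ φ.symm exteriorDisc :=
    φ.symm.differentiableOn_coe.analyticOnNhd isOpen_exteriorDisc
  have han' : AnalyticOnNhd ℂ φ'.symm exteriorDisc :=
    φ'.symm.differentiableOn_coe.analyticOnNhd isOpen_exteriorDisc
  have heq : EqOn φ.symm φ'.symm exteriorDisc :=
    han.eqOn_of_preconnected_of_eventuallyEq han' isPreconnected_exteriorDisc hw₀ hnhds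
  -- the images of the exterior disc are the two Loewner domains
  have hD : (C.hull t)ᶜ = (C'.hull t)ᶜ := by
    rw [← φ.symm.bijOn.image_eq, ← φ'.symm.bijOn.image_eq]
    exact heq.image_eq
  exact compl_inj_iff.mp hD

/-- **The named fact `WholePlaneLoewnerChain.exists_unique` reduces to existence**: given a
whole-plane Loewner chain for every continuous driving angle (Lawler (2005), Prop. 4.21,
existence half — the deep input, not proved here), the full existence-and-uniqueness statement
follows from `WholePlaneLoewnerChain.unique`. [cite: Lawler2005, Prop. 4.21] -/
theorem exists_unique_of_forall_nonempty
    (h : ∀ lam : ℝ → ℝ, Continuous lam → Nonempty (WholePlaneLoewnerChain lam)) :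
    WholePlaneLoewnerChain.exists_unique :=
  fun lam hlam ↦ ⟨h lam hlam, fun C C' t ↦ C.unique C' t⟩

end WholePlaneLoewnerChain

end Unique

end Literature.Probability.RandomPlanarGeometry
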